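import Summits.QuantumFields.YangMills.Theorems.PoincareLipschitzSphereMapBoxAverageLetters
import Summits.QuantumFields.YangMills.Theorems.PoincareLipschitzSphereMapNestedMeans
import Summits.QuantumFields.YangMills.Theorems.PoincareLipschitzVarRadiusDoubleCount

/-!
# Line «poincare_lipschitz» on crux `HistoryTailL` (stmt-QuantumFields-19936), route crux `BlockLipschitzL` (stmt-QuantumFields-23533), K2 organ of record LOC-REG-MIN —
# FLAT SHADOW «ENERGY → RANGE» (E→R) FOR LATTICE MINIMISERS INTO A SPHERE, FILE 4: THE VARIABLE-RADIUS MOLLIFIER HAS ENERGY `≲ E(u)` —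
# `Σ_{x∈X} Σ_μ ‖ū_{σ(x+e_μ)}(x+e_μ) − ū_{σ(x)}(x)‖² ≤ d·(2+4d)²·d·21^d·(A+B+1)^d · Σ_{y∈U} Σ_ν ‖u(y+e_ν) − u(y)‖²` for a bond-Lipschitz, comparable radius `σ`

Cell `ym3-torus` (YM ladder rung R3 = continuum SU(2) Yang–Mills on the three-torus — a RUNG, NOT the Clay problem: not d = 4, not infinite volume, not a mass gap); width seat
`ym-ust-19936-w5` gen 12 (LEAD ym-ust-19936-w1 g8 2026-08-29T05:15:34Z «F4 of record: ★w5's σ + F2 ∘ my F4-core»; my LOCATE `E2R-ROAD-w5g12.md` §2 (iv), §3 F4).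
THEOREMS ONLY (def-free; the mollified field is written `(#Q_{σ(x)}(x))⁻¹ • Σ_{Q_{σ(x)}(x)} u` in place), values in any real inner-product space `V`, lattice letters of lit
✓`B4Eq19LatticeOperators`; COMPOSES ★w5 g12's ✓`PoincareLipschitzSphereMapBoxAverageLetters` (adjacent centres), ✓`PoincareLipschitzSphereMapNestedMeans` (sharp nested means)
and LEAD ★w1 g8's ✓`PoincareLipschitzVarRadiusDoubleCount.sum_boxAvg_varRadius_le` (the double count); `--supports stmt-QuantumFields-19936`.  Nothing here proves E→R,
LOC-REG-MIN, `hReg`, a stub, `BlockLipschitzL`, `HistoryTailL` or a summit statement; nothing twisted ∕ covariant is in this file.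

THE RADIUS FUNCTION is ABSTRACT: `σ : ℤ^d → ℤ`, `σ ≥ 0`, BOND-LIPSCHITZ on the centre set `X` (`|σ(x+e_μ) − σ(x)| ≤ 1`) and COMPARABLE in LEAD's sense
(`σ x ≤ A·σ x′ + B` whenever `Q_{σ(x)+2}(x)` and `Q_{σ(x′)+2}(x′)` meet); for the Schoen–Uhlenbeck layer `σ = ⌊θ·depth⌋`, `θ ≤ ¼`, gives `A = B = 2` (F5's one line).
* §1 `inv_pow_le_mul_inv_pow` (`b ≤ k·a` ⇒ `(a^d)⁻¹ ≤ k^d·(b^d)⁻¹`), the three weight comparisons `inv_card_self_le` (`(2s+1)^{−d} ≤ 5^d·w`), `ratio_up_le`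
  (`d·(2s+3)^d·(2s+1)^{−2d} ≤ d·15^d·w`), `ratio_down_le` (`d·(2s+1)^d·(2s−1)^{−2d} ≤ d·21^d·w`, `s ≥ 1`), `w = ((2(s+2)+1)^d)⁻¹` LEAD's weight;
  `box_subset_box_succ_shift` (`Q_s(x) ⊆ Q_{s+1}(x+e_μ)`), `box_shift_pred_subset_box` (`Q_{s−1}(x+e_μ) ⊆ Q_s(x)`), `box_shift_succ_subset` (`Q_{s+1}(x+e_μ) ⊆ Q_{s+2}(x)`).
* §2 ★★ `normSq_mollifier_bond_le` — PER BOND, the three cases `σ(x+e_μ) ∈ {σ(x)−1, σ(x), σ(x)+1}`: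
  `‖ū_{σ(x+e_μ)}(x+e_μ) − ū_{σ(x)}(x)‖² ≤ (2+4d)²·d·21^d · w(x) · Σ_{y∈Q_{σ(x)+2}(x)} Σ_ν ‖u(y+e_ν) − u(y)‖²` (and `5^d·w` in the equal-radius case).
* §3 ★★★ `energy_mollifier_le` — THE LAYER SUM: `Σ_{x∈X}Σ_μ ‖…‖² ≤ d·((2+4d)²·d·21^d)·(A+B+1)^d · Σ_{y∈U}Σ_ν‖u(y+e_ν) − u(y)‖²` for `U ⊇ ⋃_{x∈X} Q_{σ(x)+2}(x)`.
[folklore] ([SchoenUhlenbeck1982] §4: the energy of the variable-radius mollification is `≲` the energy; the lattice statements are this file's).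
-/

set_option autoImplicit false

noncomputable section

open scoped BigOperators
open Finset

namespace Summit.QuantumFields.YangMills.Theorems.PoincareLipschitzSphereMapVarRadiusMollifier

open Literature.MathematicalPhysics.QuantumFieldTheory.Balaban1983to89
open B4Eq19LatticeOperators
open Summit.QuantumFields.YangMills.Theorems.PoincareLipschitzSphereMapBoxAverageLetters (normSq_boxMean_shift_sub_le)
open Summit.QuantumFields.YangMills.Theorems.PoincareLipschitzSphereMapNestedMeans (normSq_mean_sub_mean_le_of_nested)
open Summit.QuantumFields.YangMills.Theorems.PoincareLipschitzVarRadiusDoubleCount (sum_boxAvg_varRadius_le)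

variable {d : ℕ} {V : Type*} [NormedAddCommGroup V] [InnerProductSpace ℝ V]

/-! ## §1 Weights and box inclusions -/

/-- `0 < a`, `b ≤ k·a` ⟹ `(b^d)⁻¹ ≥ (k^d)⁻¹·(a^d)⁻¹`, i.e. `(a^d)⁻¹ ≤ k^d·(b^d)⁻¹` (`0 < b`). [folklore] -/
theorem inv_pow_le_mul_inv_pow {a b k : ℝ} (ha : 0 < a) (hb : 0 < b) (hbk : b ≤ k * a) :
    (a ^ d)⁻¹ ≤ k ^ d * (b ^ d)⁻¹ := by
  have hk : 0 < k := by nlinarith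
  have h1 : b ^ d ≤ (k * a) ^ d := pow_le_pow_left₀ hb.le hbk d
  rw [mul_pow] at h1
  have hbd : 0 < b ^ d := pow_pos hb d
  have had : 0 < a ^ d := pow_pos ha d
  have hkd : 0 < k ^ d := pow_pos hk d
  rw [inv_le_iff_one_le_mul₀ had]
  calc (1 : ℝ) = b ^ d * (b ^ d)⁻¹ := (mul_inv_cancel₀ hbd.ne').symm
    _ ≤ (k ^ d * a ^ d) * (b ^ d)⁻¹ := mul_le_mul_of_nonneg_right h1 (inv_pos.2 hbd).le
    _ = k ^ d * (b ^ d)⁻¹ * a ^ d := by ring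

/-- Equal radii: `((2s+1)^d)⁻¹ ≤ 5^d · ((2(s+2)+1)^d)⁻¹` (`s ≥ 0`). [folklore] -/
theorem inv_card_self_le {s : ℤ} (hs : 0 ≤ s) :
    ((((2 * s + 1 : ℤ) : ℝ) ^ d))⁻¹ ≤ (5 : ℝ) ^ d * ((((2 * (s + 2) + 1 : ℤ) : ℝ) ^ d))⁻¹ := by
  refine inv_pow_le_mul_inv_pow (by exact_mod_cast (show (0:ℤ) < 2 * s + 1 by linarith)) (by exact_mod_cast (show (0:ℤ) < 2 * (s + 2) + 1 by linarith)) ?_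
  exact_mod_cast (show (2 * (s + 2) + 1 : ℤ) ≤ 5 * (2 * s + 1) by linarith)

/-- Radius up by one: `d·(2s+3)^d·((2s+1)^d)⁻¹² ≤ d·15^d·((2(s+2)+1)^d)⁻¹` (`s ≥ 0`). [folklore] -/
theorem ratio_up_le {s : ℤ} (hs : 0 ≤ s) :
    (d : ℝ) * ((2 * (s + 1) + 1 : ℤ) : ℝ) ^ d * (((((2 * s + 1 : ℤ) : ℝ) ^ d))⁻¹) ^ 2 ≤
      (d : ℝ) * (15 : ℝ) ^ d * ((((2 * (s + 2) + 1 : ℤ) : ℝ) ^ d))⁻¹ := by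
  have h1 : (0 : ℝ) < ((2 * s + 1 : ℤ) : ℝ) := by exact_mod_cast (show (0:ℤ) < 2 * s + 1 by linarith)
  have h3 : ((2 * (s + 1) + 1 : ℤ) : ℝ) ≤ 3 * ((2 * s + 1 : ℤ) : ℝ) := by exact_mod_cast (show (2 * (s + 1) + 1 : ℤ) ≤ 3 * (2 * s + 1) by linarith)
  have h30 : (0 : ℝ) ≤ ((2 * (s + 1) + 1 : ℤ) : ℝ) := by exact_mod_cast (show (0:ℤ) ≤ 2 * (s + 1) + 1 by linarith)
  have hA : ((2 * (s + 1) + 1 : ℤ) : ℝ) ^ d ≤ (3 : ℝ) ^ d * ((2 * s + 1 : ℤ) : ℝ) ^ d := by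
    rw [← mul_pow]; exact pow_le_pow_left₀ h30 h3 d
  have hB := inv_card_self_le (d := d) hs
  have hpos : 0 < (((2 * s + 1 : ℤ) : ℝ) ^ d) := pow_pos h1 d
  have hinv0 : 0 ≤ ((((2 * s + 1 : ℤ) : ℝ) ^ d))⁻¹ := (inv_pos.2 hpos).le
  -- `(2s+3)^d · inv² ≤ 3^d (2s+1)^d inv · inv = 3^d · inv ≤ 3^d 5^d w`
  calc (d : ℝ) * ((2 * (s + 1) + 1 : ℤ) : ℝ) ^ d * (((((2 * s + 1 : ℤ) : ℝ) ^ d))⁻¹) ^ 2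
      ≤ (d : ℝ) * ((3 : ℝ) ^ d * ((2 * s + 1 : ℤ) : ℝ) ^ d) * (((((2 * s + 1 : ℤ) : ℝ) ^ d))⁻¹) ^ 2 := by
        exact mul_le_mul_of_nonneg_right (mul_le_mul_of_nonneg_left hA (Nat.cast_nonneg d)) (sq_nonneg _)
    _ = (d : ℝ) * (3 : ℝ) ^ d * ((((2 * s + 1 : ℤ) : ℝ) ^ d))⁻¹ := by
        rw [sq, ← mul_assoc]; field_simp
    _ ≤ (d : ℝ) * (3 : ℝ) ^ d * ((5 : ℝ) ^ d * ((((2 * (s + 2) + 1 : ℤ) : ℝ) ^ d))⁻¹) := mul_le_mul_of_nonneg_left hB (by positivity)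
    _ = (d : ℝ) * (15 : ℝ) ^ d * ((((2 * (s + 2) + 1 : ℤ) : ℝ) ^ d))⁻¹ := by
        rw [show (15 : ℝ) ^ d = 3 ^ d * 5 ^ d by rw [← mul_pow]; norm_num]; ring

/-- Radius down by one: `d·(2s+1)^d·((2s−1)^d)⁻¹² ≤ d·21^d·((2(s+2)+1)^d)⁻¹` (`s ≥ 1`). [folklore] -/
theorem ratio_down_le {s : ℤ} (hs : 1 ≤ s) :
    (d : ℝ) * ((2 * s + 1 : ℤ) : ℝ) ^ d * (((((2 * (s - 1) + 1 : ℤ) : ℝ) ^ d))⁻¹) ^ 2 ≤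
      (d : ℝ) * (21 : ℝ) ^ d * ((((2 * (s + 2) + 1 : ℤ) : ℝ) ^ d))⁻¹ := by
  have h1 : (0 : ℝ) < ((2 * (s - 1) + 1 : ℤ) : ℝ) := by exact_mod_cast (show (0:ℤ) < 2 * (s - 1) + 1 by linarith)
  have h3 : ((2 * s + 1 : ℤ) : ℝ) ≤ 3 * ((2 * (s - 1) + 1 : ℤ) : ℝ) := by exact_mod_cast (show (2 * s + 1 : ℤ) ≤ 3 * (2 * (s - 1) + 1) by linarith)
  have h30 : (0 : ℝ) ≤ ((2 * s + 1 : ℤ) : ℝ) := by exact_mod_cast (show (0:ℤ) ≤ 2 * s + 1 by linarith)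
  have hA : ((2 * s + 1 : ℤ) : ℝ) ^ d ≤ (3 : ℝ) ^ d * ((2 * (s - 1) + 1 : ℤ) : ℝ) ^ d := by
    rw [← mul_pow]; exact pow_le_pow_left₀ h30 h3 d
  have hB : ((((2 * (s - 1) + 1 : ℤ) : ℝ) ^ d))⁻¹ ≤ (7 : ℝ) ^ d * ((((2 * (s + 2) + 1 : ℤ) : ℝ) ^ d))⁻¹ :=
    inv_pow_le_mul_inv_pow h1 (by exact_mod_cast (show (0:ℤ) < 2 * (s + 2) + 1 by linarith))
      (by exact_mod_cast (show (2 * (s + 2) + 1 : ℤ) ≤ 7 * (2 * (s - 1) + 1) by linarith))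
  have hpos : 0 < (((2 * (s - 1) + 1 : ℤ) : ℝ) ^ d) := pow_pos h1 d
  calc (d : ℝ) * ((2 * s + 1 : ℤ) : ℝ) ^ d * (((((2 * (s - 1) + 1 : ℤ) : ℝ) ^ d))⁻¹) ^ 2
      ≤ (d : ℝ) * ((3 : ℝ) ^ d * ((2 * (s - 1) + 1 : ℤ) : ℝ) ^ d) * (((((2 * (s - 1) + 1 : ℤ) : ℝ) ^ d))⁻¹) ^ 2 := by
        exact mul_le_mul_of_nonneg_right (mul_le_mul_of_nonneg_left hA (Nat.cast_nonneg d)) (sq_nonneg _)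
    _ = (d : ℝ) * (3 : ℝ) ^ d * ((((2 * (s - 1) + 1 : ℤ) : ℝ) ^ d))⁻¹ := by
        rw [sq, ← mul_assoc]; field_simp
    _ ≤ (d : ℝ) * (3 : ℝ) ^ d * ((7 : ℝ) ^ d * ((((2 * (s + 2) + 1 : ℤ) : ℝ) ^ d))⁻¹) := mul_le_mul_of_nonneg_left hB (by positivity)
    _ = (d : ℝ) * (21 : ℝ) ^ d * ((((2 * (s + 2) + 1 : ℤ) : ℝ) ^ d))⁻¹ := by
        rw [show (21 : ℝ) ^ d = 3 ^ d * 7 ^ d by rw [← mul_pow]; norm_num]; ring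

/-- `Q_s(x) ⊆ Q_{s+1}(x + e_μ)`. [folklore] -/
theorem box_subset_box_succ_shift (x : Zd d) (s : ℤ) (μ : Fin d) : box x s ⊆ box (x + unitVec μ) (s + 1) := by
  refine box_subset_box fun i => ?_
  have : |x i - (x + unitVec μ) i| ≤ 1 := by
    simp only [Pi.add_apply, sub_add_cancel_left, abs_neg]; exact abs_unitVec_apply_le μ i
  linarith

/-- `Q_{s−1}(x + e_μ) ⊆ Q_s(x)`. [folklore] -/
theorem box_shift_pred_subset_box (x : Zd d) (s : ℤ) (μ : Fin d) : box (x + unitVec μ) (s - 1) ⊆ box x s := by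
  refine box_subset_box fun i => ?_
  have : |(x + unitVec μ) i - x i| ≤ 1 := by
    simp only [Pi.add_apply, add_sub_cancel_left]; exact abs_unitVec_apply_le μ i
  linarith

/-- `Q_{s+1}(x + e_μ) ⊆ Q_{s+2}(x)`. [folklore] -/
theorem box_shift_succ_subset (x : Zd d) (s : ℤ) (μ : Fin d) : box (x + unitVec μ) (s + 1) ⊆ box x (s + 2) := by
  refine box_subset_box fun i => ?_
  have : |(x + unitVec μ) i - x i| ≤ 1 := by
    simp only [Pi.add_apply, add_sub_cancel_left]; exact abs_unitVec_apply_le μ i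
  linarith

/-! ## §2 The per-bond bound -/

/-- ★★ **THE MOLLIFIER, PER BOND.**  `σ(x), σ(x+e_μ) ≥ 0` with `|σ(x+e_μ) − σ(x)| ≤ 1` ⟹
`‖ū_{σ(x+e_μ)}(x+e_μ) − ū_{σ(x)}(x)‖² ≤ (2+4d)²·d·21^d · ((2(σ(x)+2)+1)^d)⁻¹ · Σ_{y∈Q_{σ(x)+2}(x)} Σ_ν ‖u(y+e_ν) − u(y)‖²` — the three cases: equal radii
(✓`normSq_boxMean_shift_sub_le`, adjacent centres), radius up (`Q_{σ}(x) ⊆ Q_{σ+1}(x+e_μ)`, ✓`normSq_mean_sub_mean_le_of_nested`), radius down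
(`Q_{σ−1}(x+e_μ) ⊆ Q_σ(x)`, same). [folklore] [cite: SchoenUhlenbeck1982, §4] -/
theorem normSq_mollifier_bond_le (u : Zd d → V) (σ : Zd d → ℤ) (x : Zd d) (μ : Fin d) (hσx : 0 ≤ σ x) (hσx' : 0 ≤ σ (x + unitVec μ))
    (hLip : |σ (x + unitVec μ) - σ x| ≤ 1) :
    ‖(((box (x + unitVec μ) (σ (x + unitVec μ))).card : ℝ))⁻¹ • ∑ y ∈ box (x + unitVec μ) (σ (x + unitVec μ)), u y -
        (((box x (σ x)).card : ℝ))⁻¹ • ∑ y ∈ box x (σ x), u y‖ ^ 2 ≤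
      ((2 + 4 * (d : ℝ)) ^ 2 * d * (21 : ℝ) ^ d) * (((((2 * (σ x + 2) + 1 : ℤ) : ℝ) ^ d))⁻¹ *
        ∑ y ∈ box x (σ x + 2), ∑ ν, ‖u (y + unitVec ν) - u y‖ ^ 2) := by
  set s := σ x with hs
  set S : ℝ := ∑ y ∈ box x (s + 2), ∑ ν, ‖u (y + unitVec ν) - u y‖ ^ 2 with hS
  set w : ℝ := ((((2 * (s + 2) + 1 : ℤ) : ℝ) ^ d))⁻¹ with hw
  have hS0 : 0 ≤ S := Finset.sum_nonneg fun _ _ => Finset.sum_nonneg fun _ _ => by positivity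
  have hw0 : 0 ≤ w := by rw [hw]; exact (inv_pos.2 (pow_pos (by exact_mod_cast (show (0:ℤ) < 2 * (s + 2) + 1 by linarith)) d)).le
  -- energy over a sub-box is bounded by `S`
  have hmonoS : ∀ Q : Finset (Zd d), Q ⊆ box x (s + 2) → ∑ y ∈ Q, ∑ ν, ‖u (y + unitVec ν) - u y‖ ^ 2 ≤ S := fun Q hQ =>
    Finset.sum_le_sum_of_subset_of_nonneg hQ fun _ _ _ => Finset.sum_nonneg fun _ _ => by positivity
  -- the three cases
  have hcases : σ (x + unitVec μ) = s ∨ σ (x + unitVec μ) = s + 1 ∨ σ (x + unitVec μ) = s - 1 := by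
    rcases abs_le.1 hLip with ⟨h1, h2⟩; omega
  have hdpos : 0 < d := lt_of_le_of_lt (Nat.zero_le _) μ.is_lt
  have hd1' : (1 : ℝ) ≤ d := by exact_mod_cast hdpos
  have hge1 : (1 : ℝ) ≤ (2 + 4 * (d : ℝ)) ^ 2 * d := by nlinarith
  have h15 : (15 : ℝ) ^ d ≤ 21 ^ d := pow_le_pow_left₀ (by norm_num) (by norm_num) d
  have h5 : (5 : ℝ) ^ d ≤ 21 ^ d := pow_le_pow_left₀ (by norm_num) (by norm_num) d
  have hwS : 0 ≤ w * S := mul_nonneg hw0 hS0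
  -- the common last step: `C·c^d·w·S ≤ K·(w·S)` for `c^d ≤ 21^d`, `C ≤ (2+4d)²d`
  have hfinal : ∀ {C c : ℝ}, 0 ≤ C → C ≤ (2 + 4 * (d : ℝ)) ^ 2 * d → 0 ≤ c → c ≤ (21 : ℝ) ^ d →
      C * c * (w * S) ≤ ((2 + 4 * (d : ℝ)) ^ 2 * d * (21 : ℝ) ^ d) * (w * S) := by
    intro C c hC hCle hc hcle
    have := mul_le_mul hCle hcle hc (by positivity)
    exact mul_le_mul_of_nonneg_right this hwS
  rcases hcases with h | h | h
  · -- equal radii: adjacent centres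
    rw [h]
    have h1 := normSq_boxMean_shift_sub_le u x hσx μ
    have h2 : ∑ y ∈ box x s, ‖u (y + unitVec μ) - u y‖ ^ 2 ≤ S := by
      refine (Finset.sum_le_sum fun y _ => ?_).trans (hmonoS (box x s) (box_mono x (by linarith)))
      exact Finset.single_le_sum (f := fun ν => ‖u (y + unitVec ν) - u y‖ ^ 2) (fun _ _ => by positivity) (Finset.mem_univ μ)
    have hcard : (((box x s).card : ℝ))⁻¹ ≤ (5 : ℝ) ^ d * w := by rw [card_box x hσx]; exact inv_card_self_le hσx
    calc _ ≤ (((box x s).card : ℝ))⁻¹ * ∑ y ∈ box x s, ‖u (y + unitVec μ) - u y‖ ^ 2 := h1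
      _ ≤ ((5 : ℝ) ^ d * w) * S := mul_le_mul hcard h2 (Finset.sum_nonneg fun _ _ => by positivity) (by positivity)
      _ = 1 * (5 : ℝ) ^ d * (w * S) := by ring
      _ ≤ _ := hfinal zero_le_one hge1 (by positivity) h5
  · -- radius up: `Q_s(x) ⊆ Q_{s+1}(x+e_μ)`
    rw [h]
    have hsub := box_subset_box_succ_shift x s μ
    have h1 := normSq_mean_sub_mean_le_of_nested u (x := x + unitVec μ) (x' := x) (σ := s + 1) (σ' := s) (by linarith) hσx hsub (le_refl _)
    have h2 : ∑ y ∈ box (x + unitVec μ) (s + 1), ∑ ν, ‖u (y + unitVec ν) - u y‖ ^ 2 ≤ S := hmonoS _ (box_shift_succ_subset x s μ)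
    have hfac : (d : ℝ) * ((box (x + unitVec μ) (s + 1)).card : ℝ) * ((((box x s).card : ℝ))⁻¹) ^ 2 ≤ (d : ℝ) * (15 : ℝ) ^ d * w := by
      rw [card_box _ (by linarith : (0 : ℤ) ≤ s + 1), card_box x hσx]; exact ratio_up_le hσx
    calc _ ≤ _ := h1
      _ ≤ (2 + 4 * (d : ℝ)) ^ 2 * ((d : ℝ) * (15 : ℝ) ^ d * w) * S :=
          mul_le_mul (mul_le_mul_of_nonneg_left hfac (sq_nonneg _)) h2 (Finset.sum_nonneg fun _ _ => Finset.sum_nonneg fun _ _ => by positivity)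
            (by positivity)
      _ = ((2 + 4 * (d : ℝ)) ^ 2 * d) * (15 : ℝ) ^ d * (w * S) := by ring
      _ ≤ _ := hfinal (by positivity) le_rfl (by positivity) h15
  · -- radius down: `Q_{s−1}(x+e_μ) ⊆ Q_s(x)`; here `s ≥ 1`
    rw [h]
    have hs1 : 1 ≤ s := by rw [h] at hσx'; linarith
    have hsub := box_shift_pred_subset_box x s μ
    have h1 := normSq_mean_sub_mean_le_of_nested u (x := x) (x' := x + unitVec μ) (σ := s) (σ' := s - 1) hσx (by linarith) hsub (by linarith)
    rw [norm_sub_rev]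
    have h2 : ∑ y ∈ box x s, ∑ ν, ‖u (y + unitVec ν) - u y‖ ^ 2 ≤ S := hmonoS _ (box_mono x (by linarith))
    have hfac : (d : ℝ) * ((box x s).card : ℝ) * ((((box (x + unitVec μ) (s - 1)).card : ℝ))⁻¹) ^ 2 ≤ (d : ℝ) * (21 : ℝ) ^ d * w := by
      rw [card_box x hσx, card_box _ (by linarith : (0 : ℤ) ≤ s - 1)]; exact ratio_down_le hs1
    calc _ ≤ _ := h1
      _ ≤ (2 + 4 * (d : ℝ)) ^ 2 * ((d : ℝ) * (21 : ℝ) ^ d * w) * S :=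
          mul_le_mul (mul_le_mul_of_nonneg_left hfac (sq_nonneg _)) h2 (Finset.sum_nonneg fun _ _ => Finset.sum_nonneg fun _ _ => by positivity)
            (by positivity)
      _ = _ := by ring

/-! ## §3 The layer sum -/

/-- ★★★ **THE VARIABLE-RADIUS MOLLIFIER HAS ENERGY `≲ E(u)`.**  `σ : ℤ^d → ℤ`, `σ ≥ 0`; `X` a finite set of centres on which `σ` is bond-Lipschitz
(`|σ(x+e_μ) − σ(x)| ≤ 1`, all `μ`); LEAD's comparability `σ x ≤ A·σ x′ + B` whenever `Q_{σ(x)+2}(x) ∩ Q_{σ(x′)+2}(x′) ≠ ∅` (`A ≥ 1`); `U ⊇ Q_{σ(x)+2}(x)` for `x ∈ X`.  THEN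
`Σ_{x∈X} Σ_μ ‖ū_{σ(x+e_μ)}(x+e_μ) − ū_{σ(x)}(x)‖² ≤ d·((2+4d)²·d·21^d)·(A+B+1)^d · Σ_{y∈U} Σ_ν ‖u(y+e_ν) − u(y)‖²` — `normSq_mollifier_bond_le` bond by bond, then
LEAD ★w1 g8's ✓`sum_boxAvg_varRadius_le`. [folklore] [cite: SchoenUhlenbeck1982, §4] -/
theorem energy_mollifier_le (u : Zd d → V) (σ : Zd d → ℤ) (hσ : ∀ x, 0 ≤ σ x) (A B : ℕ) (hA : 1 ≤ A)
    (hcomp : ∀ x x' y : Zd d, y ∈ box x (σ x + 2) → y ∈ box x' (σ x' + 2) → σ x ≤ (A : ℤ) * σ x' + B)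
    (X U : Finset (Zd d)) (hLip : ∀ x ∈ X, ∀ μ : Fin d, |σ (x + unitVec μ) - σ x| ≤ 1) (hU : ∀ x ∈ X, box x (σ x + 2) ⊆ U) :
    ∑ x ∈ X, ∑ μ, ‖(((box (x + unitVec μ) (σ (x + unitVec μ))).card : ℝ))⁻¹ • ∑ y ∈ box (x + unitVec μ) (σ (x + unitVec μ)), u y -
        (((box x (σ x)).card : ℝ))⁻¹ • ∑ y ∈ box x (σ x), u y‖ ^ 2 ≤
      (d : ℝ) * ((2 + 4 * (d : ℝ)) ^ 2 * d * (21 : ℝ) ^ d) * ((A : ℝ) + B + 1) ^ d * ∑ y ∈ U, ∑ ν, ‖u (y + unitVec ν) - u y‖ ^ 2 := by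
  set K : ℝ := (2 + 4 * (d : ℝ)) ^ 2 * d * (21 : ℝ) ^ d with hK
  have hK0 : 0 ≤ K := by positivity
  set c : Zd d → ℝ := fun y => ∑ ν, ‖u (y + unitVec ν) - u y‖ ^ 2 with hc
  have hc0 : ∀ y, 0 ≤ c y := fun y => Finset.sum_nonneg fun _ _ => by positivity
  -- bond by bond
  have h1 : ∀ x ∈ X, ∑ μ : Fin d, ‖(((box (x + unitVec μ) (σ (x + unitVec μ))).card : ℝ))⁻¹ • ∑ y ∈ box (x + unitVec μ) (σ (x + unitVec μ)), u y -
        (((box x (σ x)).card : ℝ))⁻¹ • ∑ y ∈ box x (σ x), u y‖ ^ 2 ≤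
      (d : ℝ) * (K * (((((2 * (σ x + 2) + 1 : ℤ) : ℝ) ^ d))⁻¹ * ∑ y ∈ box x (σ x + 2), c y)) := by
    intro x hx
    calc _ ≤ ∑ _μ : Fin d, K * (((((2 * (σ x + 2) + 1 : ℤ) : ℝ) ^ d))⁻¹ * ∑ y ∈ box x (σ x + 2), c y) :=
          Finset.sum_le_sum fun μ _ => normSq_mollifier_bond_le u σ x μ (hσ x) (hσ _) (hLip x hx μ)
      _ = _ := by rw [Finset.sum_const, Finset.card_univ, Fintype.card_fin, nsmul_eq_mul]
  have h2 := sum_boxAvg_varRadius_le σ hσ A B hA hcomp X U hU c fun y _ => hc0 y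
  calc _ ≤ ∑ x ∈ X, (d : ℝ) * (K * (((((2 * (σ x + 2) + 1 : ℤ) : ℝ) ^ d))⁻¹ * ∑ y ∈ box x (σ x + 2), c y)) := Finset.sum_le_sum h1
    _ = (d : ℝ) * K * ∑ x ∈ X, ((((2 * (σ x + 2) + 1 : ℤ) : ℝ) ^ d))⁻¹ * ∑ y ∈ box x (σ x + 2), c y := by
        rw [Finset.mul_sum]; exact Finset.sum_congr rfl fun x _ => by ring
    _ ≤ (d : ℝ) * K * (((A : ℝ) + B + 1) ^ d * ∑ y ∈ U, c y) := mul_le_mul_of_nonneg_left h2 (by positivity)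
    _ = _ := by ring

end Summit.QuantumFields.YangMills.Theorems.PoincareLipschitzSphereMapVarRadiusMollifier
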